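import Summits.BirchSwinnertonDyer.BirchSwinnertonDyer.Theorems.KatoDescentTamePotSupersingularCartanMuRoadFukudaDoorsNoGrowth
import Summits.BirchSwinnertonDyer.BirchSwinnertonDyer.Theorems.KatoDescentTamePotSupersingularCartanMuRoadDoorsTprimeFive
import Literature.NumberTheory.EllipticCurves.FineSelmerMuRoadCartanImageThreeQuadratic
import Literature.NumberTheory.IwasawaTheory.Fukuda1994Thm1RankProofs
import Literature.NumberTheory.IwasawaTheory.Fukuda1994Thm1Consequences
import HarnessLib

/-!
# KT / K9 `p = 3` Cartan μ-road — the doors with NO NAMED FACT AT ALL for statement (A) (Ferrero–Washington REMOVED): (A) at `(W,3)` and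
# U₀ `MissingUpperBoundAt W 3` from the mod-3 image predicate, a complex conjugation `c`, the `ℚ(P)`-tower datum, and ONE class-group rank
# equality on the cyclotomic `ℤ_3`-tower of each IMAGINARY QUADRATIC subfield of `ℚ(W[3])`
# (cell `bsd-potss`, seat `bsd-potss-k8t-c4` g23; route-free; `--supports stmt-BirchSwinnertonDyer-19982 --as helper`; closes nothing)

HONEST FRAMING. Route-free THEOREMS ONLY (no definition, no named fact, no `sorry`). The g22 doors (`CartanMuRoadRealDoorsNoGrowth`,
`CartanMuRoadFukudaDoorsNoGrowth`) displayed exactly one named fact for (A): `hFW` (Ferrero–Washington), used on the biquadratic subfield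
`ℚ(√−3, √d) ⊆ ℚ(W[3])` and on one quadratic field inside `ℚ(P)`. By the character count of `ClassicalMuVanishesCartanQuadraticDescent` /
`ClassicalMuVanishesCartanImageThreeQuadratic` (g23, Literature): every irreducible character of `Gal(ℚ(W[3])/ℚ) ≅ N_s(3) = D₄ / N_ns(3) = SD₁₆`
occurs in `Ind_{⟨c⟩} 1 = ℚ(P)` except the two linear characters `χ` with `χ(c) = −1`, whose fields are the two IMAGINARY QUADRATIC subfields
(`ℚ(√−3)` and one more, `K⁻`). So `hFW` is replaced by the displayed datum
  `hqrk : ∀ K ⊆ ℚ(W[3]) quadratic with K ⊄ ℚ(P), ∀ cyclotomic ℤ_3-extension κ of K, rank₃ Cl(K_{m+1}) = rank₃ Cl(K_m)`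
(Fukuda 1994 Thm. 1 (2) — a tree theorem, `fukuda1994_thm1_classGroupPRank_const_of_succ_eq_holds`; Fukuda's index is `0` on every subfield of
`ℚ(W[3])` by Serre Prop. 15, `CartanMuRoadFukudaDoorsTprime.totallyRamifiedFrom_zero_intermediateField_divisionField`), certified per row by a
class-group computation in degrees `2` and `6`. THIS FILE: §0 the certificate adapter; §1 (A) at `(W,3)` (any elliptic `W/ℚ`; K9 and KT) from
{image predicate, `W[3]` irreducible, `c`, the `ℚ(P)` datum (`μ`-form / `e`-form / rank-form), `hqrk`} — NO named fact. The U₀ doors (KT (t′) rows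
and K9 O6 rows, modulo `hKatoA hGZK hmod` ONLY) are in the sibling file `…CartanMuRoadQuadraticUpperDoors`.
Nothing is asserted about any curve; (A), Conjecture A and BSD are proved for no curve here.
[cite: Fukuda1994, Thm. 1, p. 264] [cite: CoatesSujatha2005, Thm. 3.4 (§3)] [cite: Kato2004Asterisque, Thm. 14.5 (3) (p. 236)]
[cite: Serre1972, §2.2, §2.4 Prop. 15, §5.2 (iv)] [cite: Washington1997, §13.1, §13.3 Prop. 13.23]
-/

set_option linter.dupNamespace false
set_option autoImplicit false

noncomputable section

open scoped Classical NumberField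
open Field IntermediateField WeierstrassCurve Literature.NumberTheory.EllipticCurves
  Literature.NumberTheory.EllipticCurves.Rank1Residual
  Literature.NumberTheory.EllipticCurves.Rank1Residual.Typed
  Literature.NumberTheory.GaloisRepresentations Literature.NumberTheory.SerreUniformity
  Literature.NumberTheory.IwasawaTheory
  Summit.BirchSwinnertonDyer.Rank1Residual Summit.BirchSwinnertonDyer.Rank1Residual.Additive

namespace Summit.BirchSwinnertonDyer.BirchSwinnertonDyer.Theorems.CartanMuRoadQuadraticDoors

/-! ### §0 The certificate adapter: one rank equality on the tower of a subfield of `ℚ(W[3])` ⟹ `μ = 0` (Fukuda (2), index `0`) -/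

section Adapter

variable (W : WeierstrassCurve ℚ) [W.IsElliptic]

/-- **`μ = 0` for the cyclotomic `ℤ_3`-towers of the subfields `K ⊆ ℚ(W[3])` singled out by a predicate `Q`, from ONE rank equality each**
(`W[3]` irreducible, `ρ̄_{W,3}` not onto ⟹ Fukuda's index is `0` on every subfield; Fukuda Thm. 1 (2) PROVED). NO named fact.
[cite: Fukuda1994, Thm. 1 (2), p. 264] [cite: Serre1972, §2.4 Prop. 15] -/
theorem quadMu_of_quadRankSuccEqAt (hirr : W.HasIrreducibleModPGaloisRep 3) (hns : ¬ W.HasSurjectiveModNGaloisRep 3)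
    (Q : haveI : NumberField ↥(W.divisionField 3) := NumberField.mk
      IntermediateField ℚ ↥(W.divisionField 3) → Prop) (m : ℕ)
    (hqrk : haveI : NumberField ↥(W.divisionField 3) := NumberField.mk
      ∀ K : IntermediateField ℚ ↥(W.divisionField 3), Q K →
        ∀ κE : ZpExtension ↥K 3, κE.IsCyclotomic → classGroupPRank κE (m + 1) = classGroupPRank κE m) :
    haveI : NumberField ↥(W.divisionField 3) := NumberField.mk
    ∀ K : IntermediateField ℚ ↥(W.divisionField 3), Q K →
      ∀ κE : ZpExtension ↥K 3, κE.IsCyclotomic → ClassicalMuVanishes κE := by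
  haveI : Fact (Nat.Prime 3) := ⟨Nat.prime_three⟩
  haveI : NumberField ↥(W.divisionField 3) := NumberField.mk
  intro K hK κE hκE
  exact classicalMuVanishes_of_classGroupPRank_succ_eq fukuda1994_thm1_classGroupPRank_const_of_succ_eq_holds κE
    (CartanMuRoadFukudaDoorsTprime.totallyRamifiedFrom_zero_intermediateField_divisionField W 3 hirr hns K κE hκE)
    (Nat.zero_le m) (hqrk K hK κE hκE)

end Adapter

/-! ### §1 (A) at `(W, 3)` with NO named fact -/

section ConjA

variable (W : WeierstrassCurve ℚ) [W.IsElliptic]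

/-- **(A) at `(W,3)` on a `3Nn` row from `μ(ℚ(P)) = 0` and `μ = 0` for the imaginary quadratic subfields — NO named fact**:
`HasModPImageEqNonsplitCartanNormalizer W 3`, a complex conjugation `c`, `μ = 0` for every cyclotomic `ℤ_3`-extension of the fixed field of
`c|_{ℚ(W[3])}` (`= ℚ(P)`) and of every quadratic `K ⊆ ℚ(W[3])` not fixed by `c`. [cite: CoatesSujatha2005, Thm. 3.4 (§3)]
[cite: Serre1972, §2.2, §5.2 (iv)] [cite: Washington1997, §13.1, §13.3 Prop. 13.23] -/
theorem conjA_three_of_hasModPImageEqNonsplitCartanNormalizer_of_realMu_of_quadMu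
    (himg : HasModPImageEqNonsplitCartanNormalizer W 3) {c : absoluteGaloisGroup ℚ}
    (hc : IsComplexConjugation (Rat.castHom ℝ) c)
    (hμ : ∀ κE : ZpExtension ↥(fixedField (Subgroup.zpowers (absRestrictNormalHom (W.divisionField 3) c))) 3,
      κE.IsCyclotomic → ClassicalMuVanishes κE)
    (hquad : haveI : NumberField ↥(W.divisionField 3) := NumberField.mk
      ∀ K : IntermediateField ℚ ↥(W.divisionField 3), Module.finrank ℚ ↥K = 2 →
        ¬ K ≤ fixedField (Subgroup.zpowers (absRestrictNormalHom (W.divisionField 3) c)) →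
        ∀ κE : ZpExtension ↥K 3, κE.IsCyclotomic → ClassicalMuVanishes κE)
    (κ : ZpExtension ℚ 3) (hκ : κ.IsCyclotomic) :
    ∃ (γ : absoluteGaloisGroup ℚ) (D : W.FineSelmerDualData κ γ),
      Module.Finite ℤ_[3] (RestrictScalars ℤ_[3] (IwasawaAlgebra 3) D.X) :=
  haveI : Fact (Nat.Prime 3) := ⟨Nat.prime_three⟩
  CoatesSujatha2005.fineSelmerDual_moduleFinite_of_hasModPImageEqNonsplitCartanNormalizer_three_of_quadratic W himg c
    (CartanMuRoadRealDoors.smul_smul_of_isComplexConjugation hc)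
    (CartanMuRoadRealDoors.exists_smul_ne_of_isComplexConjugation (by decide) hc)
    (CartanMuRoadRealDoors.exists_smul_ne_neg_of_isComplexConjugation (by decide) hc) hμ hquad κ hκ

/-- **(A) at `(W,3)` on a `3Ns` row from `μ(ℚ(P)) = 0` and `μ = 0` for the imaginary quadratic subfields — NO named fact.**
[cite: CoatesSujatha2005, Thm. 3.4 (§3)] [cite: Serre1972, §2.2, §5.2 (iv)] [cite: Washington1997, §13.1, §13.3 Prop. 13.23] -/
theorem conjA_three_of_hasSplitCartanNormalizerModPImage_of_realMu_of_quadMu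
    (himg : HasSplitCartanNormalizerModPImage W 3) {c : absoluteGaloisGroup ℚ}
    (hc : IsComplexConjugation (Rat.castHom ℝ) c)
    (hμ : ∀ κE : ZpExtension ↥(fixedField (Subgroup.zpowers (absRestrictNormalHom (W.divisionField 3) c))) 3,
      κE.IsCyclotomic → ClassicalMuVanishes κE)
    (hquad : haveI : NumberField ↥(W.divisionField 3) := NumberField.mk
      ∀ K : IntermediateField ℚ ↥(W.divisionField 3), Module.finrank ℚ ↥K = 2 →
        ¬ K ≤ fixedField (Subgroup.zpowers (absRestrictNormalHom (W.divisionField 3) c)) →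
        ∀ κE : ZpExtension ↥K 3, κE.IsCyclotomic → ClassicalMuVanishes κE)
    (κ : ZpExtension ℚ 3) (hκ : κ.IsCyclotomic) :
    ∃ (γ : absoluteGaloisGroup ℚ) (D : W.FineSelmerDualData κ γ),
      Module.Finite ℤ_[3] (RestrictScalars ℤ_[3] (IwasawaAlgebra 3) D.X) :=
  haveI : Fact (Nat.Prime 3) := ⟨Nat.prime_three⟩
  CoatesSujatha2005.fineSelmerDual_moduleFinite_of_hasSplitCartanNormalizerModPImage_three_of_quadratic W himg c
    (CartanMuRoadRealDoors.smul_smul_of_isComplexConjugation hc)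
    (CartanMuRoadRealDoors.exists_smul_ne_of_isComplexConjugation (by decide) hc)
    (CartanMuRoadRealDoors.exists_smul_ne_neg_of_isComplexConjugation (by decide) hc) hμ hquad κ hκ

/-- **(A) at `(W,3)` on a `3Nn` row from `μ(ℚ(P)) = 0` and ONE rank equality per imaginary quadratic subfield — NO named fact**
(`W[3]` irreducible for Fukuda's index; the door of the KT Conj-A residue rows 130095bp1 / 470304m1). [cite: Fukuda1994, Thm. 1 (2), p. 264]
[cite: CoatesSujatha2005, Thm. 3.4 (§3)] [cite: Serre1972, §2.2, §2.4 Prop. 15, §5.2 (iv)] -/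
theorem conjA_three_of_hasModPImageEqNonsplitCartanNormalizer_of_realMu_of_quadRankSuccEqAt
    (hirr : W.HasIrreducibleModPGaloisRep 3) (himg : HasModPImageEqNonsplitCartanNormalizer W 3) {c : absoluteGaloisGroup ℚ}
    (hc : IsComplexConjugation (Rat.castHom ℝ) c)
    (hμ : ∀ κE : ZpExtension ↥(fixedField (Subgroup.zpowers (absRestrictNormalHom (W.divisionField 3) c))) 3,
      κE.IsCyclotomic → ClassicalMuVanishes κE) (m : ℕ)
    (hqrk : haveI : NumberField ↥(W.divisionField 3) := NumberField.mk
      ∀ K : IntermediateField ℚ ↥(W.divisionField 3), Module.finrank ℚ ↥K = 2 →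
        ¬ K ≤ fixedField (Subgroup.zpowers (absRestrictNormalHom (W.divisionField 3) c)) →
        ∀ κE : ZpExtension ↥K 3, κE.IsCyclotomic → classGroupPRank κE (m + 1) = classGroupPRank κE m)
    (κ : ZpExtension ℚ 3) (hκ : κ.IsCyclotomic) :
    ∃ (γ : absoluteGaloisGroup ℚ) (D : W.FineSelmerDualData κ γ),
      Module.Finite ℤ_[3] (RestrictScalars ℤ_[3] (IwasawaAlgebra 3) D.X) :=
  haveI : NumberField ↥(W.divisionField 3) := NumberField.mk
  conjA_three_of_hasModPImageEqNonsplitCartanNormalizer_of_realMu_of_quadMu W himg hc hμ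
    (fun K hK2 hKc => quadMu_of_quadRankSuccEqAt W hirr
      (not_hasSurjectiveModNGaloisRep_of_hasNonsplitCartanModPImage W himg.hasNonsplitCartanModPImage)
      (fun K => Module.finrank ℚ ↥K = 2 ∧ ¬ K ≤ fixedField (Subgroup.zpowers (absRestrictNormalHom (W.divisionField 3) c))) m
      (fun K hK => hqrk K hK.1 hK.2) K ⟨hK2, hKc⟩) κ hκ

/-- **(A) at `(W,3)` on a `3Ns` row from `μ(ℚ(P)) = 0` and ONE rank equality per imaginary quadratic subfield — NO named fact.**
[cite: Fukuda1994, Thm. 1 (2), p. 264] [cite: CoatesSujatha2005, Thm. 3.4 (§3)] [cite: Serre1972, §2.2, §2.4 Prop. 15, §5.2 (iv)] -/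
theorem conjA_three_of_hasSplitCartanNormalizerModPImage_of_realMu_of_quadRankSuccEqAt
    (hirr : W.HasIrreducibleModPGaloisRep 3) (himg : HasSplitCartanNormalizerModPImage W 3) {c : absoluteGaloisGroup ℚ}
    (hc : IsComplexConjugation (Rat.castHom ℝ) c)
    (hμ : ∀ κE : ZpExtension ↥(fixedField (Subgroup.zpowers (absRestrictNormalHom (W.divisionField 3) c))) 3,
      κE.IsCyclotomic → ClassicalMuVanishes κE) (m : ℕ)
    (hqrk : haveI : NumberField ↥(W.divisionField 3) := NumberField.mk
      ∀ K : IntermediateField ℚ ↥(W.divisionField 3), Module.finrank ℚ ↥K = 2 →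
        ¬ K ≤ fixedField (Subgroup.zpowers (absRestrictNormalHom (W.divisionField 3) c)) →
        ∀ κE : ZpExtension ↥K 3, κE.IsCyclotomic → classGroupPRank κE (m + 1) = classGroupPRank κE m)
    (κ : ZpExtension ℚ 3) (hκ : κ.IsCyclotomic) :
    ∃ (γ : absoluteGaloisGroup ℚ) (D : W.FineSelmerDualData κ γ),
      Module.Finite ℤ_[3] (RestrictScalars ℤ_[3] (IwasawaAlgebra 3) D.X) :=
  haveI : NumberField ↥(W.divisionField 3) := NumberField.mk
  conjA_three_of_hasSplitCartanNormalizerModPImage_of_realMu_of_quadMu W himg hc hμ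
    (fun K hK2 hKc => quadMu_of_quadRankSuccEqAt W hirr
      (CartanMuRoadFukudaDoorsTprime.not_hasSurjectiveModNGaloisRep_of_hasSplitCartanNormalizerModPImage W himg)
      (fun K => Module.finrank ℚ ↥K = 2 ∧ ¬ K ≤ fixedField (Subgroup.zpowers (absRestrictNormalHom (W.divisionField 3) c))) m
      (fun K hK => hqrk K hK.1 hK.2) K ⟨hK2, hKc⟩) κ hκ

/-- **(A) at `(W,3)` on a `3Nn` row from `ord₃ h(ℚ(P)_{n+1}) = ord₃ h(ℚ(P)_n)` and ONE rank equality per imaginary quadratic subfield — NO named fact**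
(the door of the 19 KT `3Nn` Fukuda rows; Fukuda Thm. 1 (1) on `ℚ(P)`, (2) on the quadratic fields, both PROVED). [cite: Fukuda1994, Thm. 1, p. 264]
[cite: CoatesSujatha2005, Thm. 3.4 (§3)] [cite: Serre1972, §2.2, §2.4 Prop. 15, §5.2 (iv)] [cite: Washington1997, §13.1, §13.3 Prop. 13.23] -/
theorem conjA_three_of_hasModPImageEqNonsplitCartanNormalizer_of_realSuccEqAt_of_quadRankSuccEqAt
    (hirr : W.HasIrreducibleModPGaloisRep 3) (himg : HasModPImageEqNonsplitCartanNormalizer W 3) {c : absoluteGaloisGroup ℚ}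
    (hc : IsComplexConjugation (Rat.castHom ℝ) c) (n : ℕ)
    (hord : ∀ κE : ZpExtension ↥(fixedField (Subgroup.zpowers (absRestrictNormalHom (W.divisionField 3) c))) 3,
      κE.IsCyclotomic → classNumberPExp κE (n + 1) = classNumberPExp κE n) (m : ℕ)
    (hqrk : haveI : NumberField ↥(W.divisionField 3) := NumberField.mk
      ∀ K : IntermediateField ℚ ↥(W.divisionField 3), Module.finrank ℚ ↥K = 2 →
        ¬ K ≤ fixedField (Subgroup.zpowers (absRestrictNormalHom (W.divisionField 3) c)) →
        ∀ κE : ZpExtension ↥K 3, κE.IsCyclotomic → classGroupPRank κE (m + 1) = classGroupPRank κE m)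
    (κ : ZpExtension ℚ 3) (hκ : κ.IsCyclotomic) :
    ∃ (γ : absoluteGaloisGroup ℚ) (D : W.FineSelmerDualData κ γ),
      Module.Finite ℤ_[3] (RestrictScalars ℤ_[3] (IwasawaAlgebra 3) D.X) := by
  haveI : Fact (Nat.Prime 3) := ⟨Nat.prime_three⟩
  haveI : NumberField ↥(W.divisionField 3) := NumberField.mk
  exact conjA_three_of_hasModPImageEqNonsplitCartanNormalizer_of_realMu_of_quadRankSuccEqAt W hirr himg hc
    (fun κE hκE => classicalMuVanishes_of_classNumberPExp_succ_eq fukuda1994_thm1_classNumberPExp_const_of_succ_eq_holds κE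
      (CartanMuRoadFukudaDoorsTprime.totallyRamifiedFrom_zero_intermediateField_divisionField W 3 hirr
        (not_hasSurjectiveModNGaloisRep_of_hasNonsplitCartanModPImage W himg.hasNonsplitCartanModPImage) _ κE hκE)
      (Nat.zero_le n) (hord κE hκE)) m hqrk κ hκ

/-- **(A) at `(W,3)` on a `3Nn` row from `rank₃ Cl(ℚ(P)_{n+1}) = rank₃ Cl(ℚ(P)_n)` and ONE rank equality per imaginary quadratic subfield —
NO named fact** (the door for the KT rows 198927v1, 486720db1, 486720dc1). [cite: Fukuda1994, Thm. 1 (2), p. 264] [cite: CoatesSujatha2005, Thm. 3.4 (§3)]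
[cite: Serre1972, §2.2, §2.4 Prop. 15, §5.2 (iv)] [cite: Washington1997, §13.1, §13.3 Prop. 13.23] -/
theorem conjA_three_of_hasModPImageEqNonsplitCartanNormalizer_of_realRankSuccEqAt_of_quadRankSuccEqAt
    (hirr : W.HasIrreducibleModPGaloisRep 3) (himg : HasModPImageEqNonsplitCartanNormalizer W 3) {c : absoluteGaloisGroup ℚ}
    (hc : IsComplexConjugation (Rat.castHom ℝ) c) (n : ℕ)
    (hrk : ∀ κE : ZpExtension ↥(fixedField (Subgroup.zpowers (absRestrictNormalHom (W.divisionField 3) c))) 3,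
      κE.IsCyclotomic → classGroupPRank κE (n + 1) = classGroupPRank κE n) (m : ℕ)
    (hqrk : haveI : NumberField ↥(W.divisionField 3) := NumberField.mk
      ∀ K : IntermediateField ℚ ↥(W.divisionField 3), Module.finrank ℚ ↥K = 2 →
        ¬ K ≤ fixedField (Subgroup.zpowers (absRestrictNormalHom (W.divisionField 3) c)) →
        ∀ κE : ZpExtension ↥K 3, κE.IsCyclotomic → classGroupPRank κE (m + 1) = classGroupPRank κE m)
    (κ : ZpExtension ℚ 3) (hκ : κ.IsCyclotomic) :
    ∃ (γ : absoluteGaloisGroup ℚ) (D : W.FineSelmerDualData κ γ),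
      Module.Finite ℤ_[3] (RestrictScalars ℤ_[3] (IwasawaAlgebra 3) D.X) := by
  haveI : Fact (Nat.Prime 3) := ⟨Nat.prime_three⟩
  haveI : NumberField ↥(W.divisionField 3) := NumberField.mk
  exact conjA_three_of_hasModPImageEqNonsplitCartanNormalizer_of_realMu_of_quadRankSuccEqAt W hirr himg hc
    (fun κE hκE => classicalMuVanishes_of_classGroupPRank_succ_eq fukuda1994_thm1_classGroupPRank_const_of_succ_eq_holds κE
      (CartanMuRoadFukudaDoorsTprime.totallyRamifiedFrom_zero_intermediateField_divisionField W 3 hirr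
        (not_hasSurjectiveModNGaloisRep_of_hasNonsplitCartanModPImage W himg.hasNonsplitCartanModPImage) _ κE hκE)
      (Nat.zero_le n) (hrk κE hκE)) m hqrk κ hκ

/-- **(A) at `(W,3)` on a `3Ns` row from `ord₃ h(ℚ(P)_{n+1}) = ord₃ h(ℚ(P)_n)` and ONE rank equality per imaginary quadratic subfield — NO named fact.**
[cite: Fukuda1994, Thm. 1, p. 264] [cite: CoatesSujatha2005, Thm. 3.4 (§3)] [cite: Serre1972, §2.2, §2.4 Prop. 15, §5.2 (iv)] -/
theorem conjA_three_of_hasSplitCartanNormalizerModPImage_of_realSuccEqAt_of_quadRankSuccEqAt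
    (hirr : W.HasIrreducibleModPGaloisRep 3) (himg : HasSplitCartanNormalizerModPImage W 3) {c : absoluteGaloisGroup ℚ}
    (hc : IsComplexConjugation (Rat.castHom ℝ) c) (n : ℕ)
    (hord : ∀ κE : ZpExtension ↥(fixedField (Subgroup.zpowers (absRestrictNormalHom (W.divisionField 3) c))) 3,
      κE.IsCyclotomic → classNumberPExp κE (n + 1) = classNumberPExp κE n) (m : ℕ)
    (hqrk : haveI : NumberField ↥(W.divisionField 3) := NumberField.mk
      ∀ K : IntermediateField ℚ ↥(W.divisionField 3), Module.finrank ℚ ↥K = 2 →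
        ¬ K ≤ fixedField (Subgroup.zpowers (absRestrictNormalHom (W.divisionField 3) c)) →
        ∀ κE : ZpExtension ↥K 3, κE.IsCyclotomic → classGroupPRank κE (m + 1) = classGroupPRank κE m)
    (κ : ZpExtension ℚ 3) (hκ : κ.IsCyclotomic) :
    ∃ (γ : absoluteGaloisGroup ℚ) (D : W.FineSelmerDualData κ γ),
      Module.Finite ℤ_[3] (RestrictScalars ℤ_[3] (IwasawaAlgebra 3) D.X) := by
  haveI : Fact (Nat.Prime 3) := ⟨Nat.prime_three⟩
  haveI : NumberField ↥(W.divisionField 3) := NumberField.mk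
  exact conjA_three_of_hasSplitCartanNormalizerModPImage_of_realMu_of_quadRankSuccEqAt W hirr himg hc
    (fun κE hκE => classicalMuVanishes_of_classNumberPExp_succ_eq fukuda1994_thm1_classNumberPExp_const_of_succ_eq_holds κE
      (CartanMuRoadFukudaDoorsTprime.totallyRamifiedFrom_zero_intermediateField_divisionField W 3 hirr
        (CartanMuRoadFukudaDoorsTprime.not_hasSurjectiveModNGaloisRep_of_hasSplitCartanNormalizerModPImage W himg) _ κE hκE)
      (Nat.zero_le n) (hord κE hκE)) m hqrk κ hκ

/-- **(A) at `(W,3)` on a `3Ns` row from `rank₃ Cl(ℚ(P)_{n+1}) = rank₃ Cl(ℚ(P)_n)` and ONE rank equality per imaginary quadratic subfield — NO named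
fact.** [cite: Fukuda1994, Thm. 1 (2), p. 264] [cite: CoatesSujatha2005, Thm. 3.4 (§3)] [cite: Serre1972, §2.2, §2.4 Prop. 15, §5.2 (iv)] -/
theorem conjA_three_of_hasSplitCartanNormalizerModPImage_of_realRankSuccEqAt_of_quadRankSuccEqAt
    (hirr : W.HasIrreducibleModPGaloisRep 3) (himg : HasSplitCartanNormalizerModPImage W 3) {c : absoluteGaloisGroup ℚ}
    (hc : IsComplexConjugation (Rat.castHom ℝ) c) (n : ℕ)
    (hrk : ∀ κE : ZpExtension ↥(fixedField (Subgroup.zpowers (absRestrictNormalHom (W.divisionField 3) c))) 3,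
      κE.IsCyclotomic → classGroupPRank κE (n + 1) = classGroupPRank κE n) (m : ℕ)
    (hqrk : haveI : NumberField ↥(W.divisionField 3) := NumberField.mk
      ∀ K : IntermediateField ℚ ↥(W.divisionField 3), Module.finrank ℚ ↥K = 2 →
        ¬ K ≤ fixedField (Subgroup.zpowers (absRestrictNormalHom (W.divisionField 3) c)) →
        ∀ κE : ZpExtension ↥K 3, κE.IsCyclotomic → classGroupPRank κE (m + 1) = classGroupPRank κE m)
    (κ : ZpExtension ℚ 3) (hκ : κ.IsCyclotomic) :
    ∃ (γ : absoluteGaloisGroup ℚ) (D : W.FineSelmerDualData κ γ),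
      Module.Finite ℤ_[3] (RestrictScalars ℤ_[3] (IwasawaAlgebra 3) D.X) := by
  haveI : Fact (Nat.Prime 3) := ⟨Nat.prime_three⟩
  haveI : NumberField ↥(W.divisionField 3) := NumberField.mk
  exact conjA_three_of_hasSplitCartanNormalizerModPImage_of_realMu_of_quadRankSuccEqAt W hirr himg hc
    (fun κE hκE => classicalMuVanishes_of_classGroupPRank_succ_eq fukuda1994_thm1_classGroupPRank_const_of_succ_eq_holds κE
      (CartanMuRoadFukudaDoorsTprime.totallyRamifiedFrom_zero_intermediateField_divisionField W 3 hirr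
        (CartanMuRoadFukudaDoorsTprime.not_hasSurjectiveModNGaloisRep_of_hasSplitCartanNormalizerModPImage W himg) _ κE hκE)
      (Nat.zero_le n) (hrk κE hκE)) m hqrk κ hκ

end ConjA

end Summit.BirchSwinnertonDyer.BirchSwinnertonDyer.Theorems.CartanMuRoadQuadraticDoors

end
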